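/-
Copyright (c) 2026. All rights reserved.
Released under Apache 2.0 license as described in the file LICENSE.
-/
import Literature.NumberTheory.QuadraticFields.HurwitzClassNumberCongruences
import Literature.NumberTheory.QuadraticFields.HurwitzClassNumberIntegrality
import HarnessLib

/-!
# Beckwith–Raum–Richter 2022, §2: the elementary steps of the proof of Theorem 1 (`ℓ ∣ b`) —
# `ℓ`-integrality of `H(N)` for `ℓ > 3`, passage to sub-progressions, Lemma 2.1 (normalisation of
# `aℤ + b`), and the reduction of Theorem 1 to its normalised case

[tag: class_number] [tag: binary_quadratic_form] [tag: modular_form]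

Topic `NumberTheory/QuadraticFields`; THEOREMS ONLY (no definition, no named fact, no instance; net
Literature debt 0). Seat `bsd-input-brr2022` (INPUTS→unconditional, row U30: the named fact
`BRR2022_thm_1` of `HurwitzClassNumberCongruences.lean`, Beckwith–Raum–Richter, Adv. Math. 409 (2022)
108663, Thm. 1: «Let `ℓ > 3` be a prime, `a ∈ ℤ_{≥1}`, and `b ∈ ℤ`. If `−b` is a square modulo `a`
and `H(an + b) ≡ 0 (mod ℓ)` for all integers `n`, then `ℓ ∣ b`»).

The printed proof of Theorem 1 [BeckwithRaumRichter2022, §2, pp. 6–8 of arXiv:2203.11273] runs: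
contraposition (`ℓ ∤ b`); **Lemma 2.1** replaces `(a, b)` by a sub-progression with convenient
arithmetic («Lemma 2.1 allows us to replace `a` and `b` in such a way that we can apply
Proposition 2.2»); **Proposition 2.2** computes, modulo `ℓ`, Fourier coefficients of the holomorphic
projection `π^hol_2((U_{a,b} E_{3/2})·(θ_{a,β} + θ_{a,−β}))`, a quasi-modular form of weight `2` for
`Γ_1(4a)` (Zagier's weight-`3/2` Eisenstein series, the holomorphic projection of
Imamoḡlu–Raum–Richter, the divisor-sum formula (16)–(17) of [BeckwithRaumRichter2020], and three
invocations of the 2020 theorem `ℓ ∣ a`); a **theorem of Serre** (`c(f; np^r) ≡ (r + 1) c(f; n)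
(mod ℓ)` for infinitely many `p ≡ 1 (mod ℓN)`) then contradicts those values. The analytic part
(Proposition 2.2 and Serre's theorem) needs harmonic Maass forms of half-integral weight, holomorphic
projection and Deligne–Serre congruences, none of which the tree or Mathlib has; it is NOT here.
This file proves, in the printed order, everything in that proof that is elementary:

* §1 **why `ℓ > 3`**: `12·H(N) ∈ ℤ` (tree, `HurwitzClassNumberIntegrality`) gives
  `den_hurwitzClassNumber_dvd_twelve`, hence for a prime `ℓ > 3` every `H(N)` is `ℓ`-integral
  (`not_dvd_den_hurwitzClassNumber`: «a rational number is called `ℓ`-integral if its denominator is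
  not divisible by `ℓ`» [BeckwithRaumRichter2020, §1.3]; «our papers [2020, 2022] assumed `ℓ ≥ 5`. The
  primary purpose of this assumption was to exclude the case of fractional class numbers, in
  particular the cases `H(3) = 1/3` and `H(4) = 1/2`» [BeckwithRaumRichter2024, §1, after Thm. 1.2]),
  and the congruence `H(N) ≡ 0 (mod ℓ)` (`RatCongZero ℓ (H N)`) is the integer divisibility
  `ℓ ∣ 12·H(N)` (`ratCongZero_hurwitzClassNumber_iff_dvd`).
* §2 **sub-progressions**: a Ramanujan-type congruence on `a₀ℤ + b₀` is inherited by every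
  `aℤ + b ⊆ a₀ℤ + b₀` (`a₀ ∣ a`, `b ≡ b₀ (mod a₀)`) — the use made of Lemma 2.1 (1)
  (`hurwitzCongruence_of_dvd_of_modEq`).
* §3 **Lemma 2.1** as printed (`BRR2022.exists_normalisedProgression`): given `a₀ ≥ 1`, `b₀`, `β`
  with `−b₀ ≡ β² (mod a₀)`, there are `a ≥ 1`, `b` with (1) `a₀ ∣ a`, `b ≡ b₀ (mod a₀)`; (2)
  `−b ≡ β² (mod a)`; (3) for every prime `p ∣ a`, `gcd(a_p, 2β)` is a proper divisor of the `p`-part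
  `a_p` (typed: some power `p^e ∣ a` does not divide `2β`); (4) a prime `p ∣ a` with `a < p²` and
  `0 ≤ 2β < p`. Typed-vs-printed: the printed lemma is stated for `β ∈ ℤ` but its conclusions (3)–(4)
  (and its proof, «`p > max{a′, 2β}`») silently use `2β > 0`; we assume `0 < β` (no loss: `β` matters
  only modulo `a₀`, and the reduction below picks a positive representative). Construction as
  printed up to the choice of `a′`: the paper's `a′ = ∏_{p ∣ a₀} p^{max(ord_p a₀, ord_p 2β + 1)}` is
  replaced by the cruder `a′ = a₀^{2β+1}` (also supported on the primes of `a₀`, with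
  `ord_p a′ ≥ 2β + 1 > ord_p 2β`), then a prime `P > max(a′, 2β)`, `a = a′P`, `b = −β²`.
* §4 **Remark 2.3's step** `β ≢ 0 (mod ℓ)`: `ℓ ∣ a`, `a ∣ β² + b`, `ℓ ∤ b ⟹ ℓ ∤ β`
  (`BRR2022.not_dvd_of_dvd_of_dvd_sq_add`).
* §5 **the reduction** (`BRR2022.thm_1_of_normalised`): granted the 2020 theorem `BRR2020_thm_1`
  (a named fact of the tree, used here exactly where the print uses it), Theorem 1 follows from its
  NORMALISED case — «for `ℓ > 3` prime, `a ≥ 1`, `β > 0`, `b` with `ℓ ∣ a`, `ℓ ∤ b`, `a ∣ β² + b` and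
  Lemma 2.1 (3)–(4), the congruence `H(an + b) ≡ 0 (mod ℓ)` for all `n` is impossible» — which is
  precisely what Proposition 2.2 and Serre's theorem establish in print. That normalised case is
  displayed as a HYPOTHESIS (an `∀`-statement in the theorem's signature), not minted as a named
  fact (D-0026); no `_holds` is claimed: `BRR2022_thm_1` stays a cited input.

## References

* [BeckwithRaumRichter2022] O. Beckwith, M. Raum, O. K. Richter, *Congruences of Hurwitz class numbers
  on square classes*, Adv. Math. 409 (2022) 108663 = arXiv:2203.11273 (held `paper:arxiv-2203.11273`):
  Thm. 1 (p0002 L38–46), Lemma 2.1 and Prop. 2.2 with Remark 2.3 (p0006), proof of Thm. 1 (p0008).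
* [BeckwithRaumRichter2020] O. Beckwith, M. Raum, O. K. Richter, *Nonholomorphic Ramanujan-type
  congruences for Hurwitz class numbers*, PNAS 117 (2020), §1.3 (`ℓ`-integral rationals), Thm. 1.
* [BeckwithRaumRichter2024] O. Beckwith, M. Raum, O. K. Richter, *Imaginary quadratic fields with
  ℓ-torsion-free class groups and specified split primes*, IMRN 2024 = arXiv:2305.19272, §1 (held
  `paper:arxiv-2305.19272`, p0005 L33–L57: the `ℓ ≥ 5` remark and Thms. 1.3/1.4).
-/

namespace Literature.NumberTheory.QuadraticFields

/-! ## §1 `ℓ`-integrality of `H(N)` for a prime `ℓ > 3` -/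

/-- The denominator of `H(N)` divides `12` (`12·H(N) ∈ ℤ`: weights `1, 1/2, 1/3` and `H(0) = −1/12`).
[cite: BeckwithRaumRichter2024, §1 (remark after Thm. 1.2: fractional class numbers H(3) = 1/3, H(4) = 1/2)] -/
theorem den_hurwitzClassNumber_dvd_twelve (N : ℤ) : (hurwitzClassNumber N).den ∣ 12 := by
  obtain ⟨m, hm⟩ := exists_twelve_mul_hurwitzClassNumber_eq_intCast N
  have h : hurwitzClassNumber N = (m : ℚ) / (12 : ℤ) := by
    rw [← hm]; push_cast; ring
  have := Rat.den_dvd m 12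
  rw [← Rat.intCast_div_eq_divInt, ← h] at this
  exact_mod_cast this

/-- For a prime `ℓ > 3` every Hurwitz class number is `ℓ`-integral («its denominator is not divisible
by `ℓ`») — the reason Beckwith–Raum–Richter assume `ℓ > 3` («to exclude the case of fractional class
numbers, in particular `H(3) = 1/3` and `H(4) = 1/2`»).
[cite: BeckwithRaumRichter2020, §1.3 (ℓ-integral rationals)]
[cite: BeckwithRaumRichter2024, §1 (remark after Thm. 1.2)] -/
theorem not_dvd_den_hurwitzClassNumber {ℓ : ℕ} (hℓ : ℓ.Prime) (h3 : 3 < ℓ) (N : ℤ) :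
    ¬ ℓ ∣ (hurwitzClassNumber N).den := by
  intro h
  have h12 : ℓ ∣ 12 := h.trans (den_hurwitzClassNumber_dvd_twelve N)
  have hle : ℓ ≤ 12 := Nat.le_of_dvd (by norm_num) h12
  interval_cases ℓ <;> simp_all (config := {decide := true})

/-- For a prime `ℓ > 3`, the congruence `H(N) ≡ 0 (mod ℓ)` of the `ℓ`-integral rational `H(N)` is the
integer divisibility `ℓ ∣ 12·H(N)`. [cite: BeckwithRaumRichter2020, §1.3 (ℓ-integral rationals and
their congruences)] -/
theorem ratCongZero_hurwitzClassNumber_iff_dvd {ℓ : ℕ} (hℓ : ℓ.Prime) (h3 : 3 < ℓ) {N m : ℤ}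
    (hm : (12 : ℚ) * hurwitzClassNumber N = m) :
    RatCongZero ℓ (hurwitzClassNumber N) ↔ (ℓ : ℤ) ∣ m := by
  have hℓ12 : ¬ (ℓ : ℤ) ∣ 12 := by
    intro h
    have hle : ℓ ≤ 12 := Nat.le_of_dvd (by norm_num) (by exact_mod_cast h)
    interval_cases ℓ <;> simp_all (config := {decide := true})
  have hq : hurwitzClassNumber N = Rat.divInt m 12 := by
    rw [← Rat.intCast_div_eq_divInt, ← hm]; push_cast; ring
  obtain ⟨c, hcnum, hcden⟩ := Rat.num_den_mk (by norm_num : (12 : ℤ) ≠ 0) hq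
  have hℓp : Prime (ℓ : ℤ) := Nat.prime_iff_prime_int.mp hℓ
  rw [RatCongZero]
  constructor
  · intro h
    rw [hcnum]
    exact dvd_mul_of_dvd_right h c
  · intro h
    rw [hcnum] at h
    rcases hℓp.dvd_or_dvd h with hc | hnum
    · exact absurd (hcden ▸ dvd_mul_of_dvd_left hc _) hℓ12
    · exact hnum

/-! ## §2 Passage to sub-progressions (the use of Lemma 2.1 (1)) -/

/-- A Ramanujan-type congruence `H(a₀n + b₀) ≡ 0 (mod ℓ)` (all `n ∈ ℤ`) is inherited by every
sub-progression `aℤ + b ⊆ a₀ℤ + b₀`, i.e. `a₀ ∣ a` and `b ≡ b₀ (mod a₀)` — the content of condition (1)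
of Lemma 2.1 («we have `ã ∣ a` and `b ≡ b̃ (mod ã)`»; «Lemma 2.1 allows us to replace `a` and `b`»).
[cite: BeckwithRaumRichter2022, Lemma 2.1 (1) and proof of Thm. 1] -/
theorem hurwitzCongruence_of_dvd_of_modEq {ℓ a₀ a : ℕ} {b₀ b : ℤ}
    (hcong : ∀ n : ℤ, RatCongZero ℓ (hurwitzClassNumber (a₀ * n + b₀)))
    (ha : a₀ ∣ a) (hb : b ≡ b₀ [ZMOD a₀]) (n : ℤ) :
    RatCongZero ℓ (hurwitzClassNumber (a * n + b)) := by
  obtain ⟨c, hc⟩ := ha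
  obtain ⟨t, ht⟩ := Int.modEq_iff_dvd.mp hb.symm
  have : (a : ℤ) * n + b = a₀ * (c * n + t) + b₀ := by
    rw [hc]; push_cast
    linear_combination ht
  rw [this]
  exact hcong _

namespace BRR2022

/-! ## §3 Lemma 2.1: normalisation of the progression -/

/-- **Beckwith–Raum–Richter 2022, Lemma 2.1** (normalisation of `ãℤ + b̃`). «Let `ã ∈ ℤ_{≥1}` and
`b̃, β ∈ ℤ` be such that `−b̃ ≡ β² (mod ã)`. Then there exist `a ∈ ℤ_{≥1}` and `b ∈ ℤ` such that
(1) `ã ∣ a` and `b ≡ b̃ (mod ã)`; (2) `−b ≡ β² (mod a)`; (3) for every prime `p ∣ a`, writing `a_p` for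
the `p`-part of `a`, `gcd(a_p, 2β)` is a proper divisor of `a_p`; (4) there is a prime `p ∣ a` such that
`a < p²` and `0 ≤ 2β < p`.» Here `ã, b̃ = a₀, b₀`; (3) is typed as «some power `p^e ∣ a` does not
divide `2β`» (equivalent to `a_p ∤ 2β`); `0 < β` is assumed (the printed (3)–(4) need `2β > 0`; `β`
matters only modulo `a₀`). Proof as printed with `a′ = a₀^{2β+1}` in place of
`∏_{p∣a₀} p^{max(ord_p a₀, ord_p 2β + 1)}`, a prime `P > max(a′, 2β)`, `a = a′P`, `b = −β²`.
[cite: BeckwithRaumRichter2022, Lemma 2.1] -/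
theorem exists_normalisedProgression {a₀ : ℕ} (ha₀ : 0 < a₀) {b₀ β : ℤ} (hβ : 0 < β)
    (hsq : (a₀ : ℤ) ∣ β ^ 2 + b₀) :
    ∃ (a : ℕ) (b : ℤ), 0 < a ∧ a₀ ∣ a ∧ b ≡ b₀ [ZMOD a₀] ∧ (a : ℤ) ∣ β ^ 2 + b ∧
      (∀ p : ℕ, p.Prime → p ∣ a → ∃ e : ℕ, p ^ e ∣ a ∧ ¬ ((p : ℤ) ^ e ∣ 2 * β)) ∧
      (∃ p : ℕ, p.Prime ∧ p ∣ a ∧ a < p ^ 2 ∧ 2 * β < p) := by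
  -- `m = 2β + 1`, `a' = a₀ ^ m`, a prime `P > max(a', 2β)`, `a = a' P`, `b = -β²`
  set m : ℕ := 2 * β.toNat + 1 with hm
  have hβnat : (β.toNat : ℤ) = β := Int.toNat_of_nonneg hβ.le
  have h2β : (2 * β : ℤ) = ((2 * β.toNat : ℕ) : ℤ) := by push_cast; rw [hβnat]
  obtain ⟨P, hPge, hP⟩ := Nat.exists_infinite_primes (max (a₀ ^ m) (2 * β.toNat) + 1)
  have hPa' : a₀ ^ m < P := lt_of_lt_of_le (Nat.lt_succ_of_le (le_max_left _ _)) hPge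
  have hP2β : 2 * β.toNat < P := lt_of_lt_of_le (Nat.lt_succ_of_le (le_max_right _ _)) hPge
  have ha'0 : 0 < a₀ ^ m := pow_pos ha₀ m
  refine ⟨a₀ ^ m * P, -β ^ 2, Nat.mul_pos ha'0 hP.pos, ?_, ?_, ?_, ?_, ?_⟩
  · exact (dvd_pow_self a₀ (by omega)).mul_right P
  · -- `-β² ≡ b₀ (mod a₀)` from `a₀ ∣ β² + b₀`
    exact Int.modEq_iff_dvd.mpr (by simpa [sub_neg_eq_add, add_comm] using hsq)
  · simp
  · intro p hp hpa
    rcases (Nat.Prime.dvd_mul hp).mp hpa with h | h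
    · -- `p ∣ a₀`: the power `p ^ m ∣ a` exceeds `2β`
      have hpa₀ : p ∣ a₀ := hp.dvd_of_dvd_pow h
      refine ⟨m, (pow_dvd_pow_of_dvd hpa₀ m).mul_right P, ?_⟩
      intro hdvd
      have hlt : (2 * β : ℤ) < (p : ℤ) ^ m := by
        have h1 : m < 2 ^ m := Nat.lt_two_pow_self
        have h2 : 2 ^ m ≤ p ^ m := Nat.pow_le_pow_left hp.two_le m
        rw [h2β]
        exact_mod_cast (show 2 * β.toNat < p ^ m by omega)
      have hle : (p : ℤ) ^ m ≤ 2 * β := Int.le_of_dvd (by omega) hdvd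
      exact absurd hle (not_le.mpr hlt)
    · -- `p = P`: `P ∥ a` and `P > 2β > 0`
      have hpP : p = P := (Nat.prime_dvd_prime_iff_eq hp hP).mp h
      subst hpP
      refine ⟨1, by simp, ?_⟩
      intro hdvd
      rw [pow_one] at hdvd
      have hle : (p : ℤ) ≤ 2 * β := Int.le_of_dvd (by omega) hdvd
      rw [h2β] at hle
      exact absurd (show p ≤ 2 * β.toNat by exact_mod_cast hle) (not_le.mpr hP2β)
  · refine ⟨P, hP, dvd_mul_left P _, ?_, ?_⟩
    · rw [pow_two]
      exact Nat.mul_lt_mul_of_lt_of_le hPa' le_rfl hP.pos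
    · rw [h2β]; exact_mod_cast hP2β

/-! ## §4 Remark 2.3: `β ≢ 0 (mod ℓ)` -/

/-- The step «we have `β̃ ≢ 0 (mod ℓ)`, since `−β² ≡ b ≢ 0 (mod ℓ)`» of the proof of Proposition 2.2
(it uses `ℓ ∣ a`, the 2020 theorem): if `ℓ ∣ a`, `a ∣ β² + b` and `ℓ ∤ b`, then `ℓ ∤ β`.
[cite: BeckwithRaumRichter2022, Prop. 2.2 (proof) and Remark 2.3] -/
theorem not_dvd_of_dvd_of_dvd_sq_add {ℓ a b β : ℤ} (hℓa : ℓ ∣ a) (hsq : a ∣ β ^ 2 + b)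
    (hb : ¬ ℓ ∣ b) : ¬ ℓ ∣ β := by
  intro hβ
  apply hb
  have h1 : ℓ ∣ β ^ 2 + b := hℓa.trans hsq
  have h2 : ℓ ∣ β ^ 2 := dvd_pow hβ two_ne_zero
  simpa using Int.dvd_sub h1 h2

/-! ## §5 Theorem 1 follows from its normalised case (granted the 2020 theorem) -/

/-- **The reduction step of the printed proof of [BeckwithRaumRichter2022, Thm. 1]** («We establish the
theorem by contraposition. Assume that `ℓ ∤ b`. Lemma 2.1 allows us to replace `a` and `b` in such a
way that we can apply Proposition 2.2»), kernel-checked: GRANTED the 2020 theorem `ℓ ∣ a`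
(`h20 : BRR2020_thm_1`, the tree's named fact [BeckwithRaumRichter2020, Thm. 1], invoked by the print at
this point), Theorem 1 (`BRR2022_thm_1`, verbatim) follows from its NORMALISED CASE `hnorm`: for a
prime `ℓ > 3`, `a ≥ 1`, `β > 0` and `b` with `ℓ ∣ a`, `ℓ ∤ b`, `a ∣ β² + b`, and conditions (3)–(4) of
Lemma 2.1, the congruences `H(an + b) ≡ 0 (mod ℓ)` (all `n ∈ ℤ`) are contradictory — exactly the
hypotheses of Proposition 2.2 («`β² ≡ −b (mod a)` and `b ≢ 0 (mod ℓ)` … Conditions (1)–(4) in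
Lemma 2.1») and what Proposition 2.2 with Serre's theorem yields in print. `hnorm` is displayed as a
hypothesis, not vendored as a fact; this theorem does NOT discharge `BRR2022_thm_1`.
Proof: `ℓ ∣ a₀` (2020); a positive square root `β` of `−b₀ (mod a₀)` (`|x|`, or `a₀` if `x = 0`);
`ℓ ∤ β` (§4); Lemma 2.1 (§3); `ℓ ∤ b` as `b ≡ b₀ (mod a₀)` and `ℓ ∣ a₀`; the congruence passes to
`aℤ + b` (§2); `hnorm`. [cite: BeckwithRaumRichter2022, proof of Thm. 1 (§2, after Remark 2.3)] -/
theorem thm_1_of_normalised (h20 : BRR2020_thm_1)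
    (hnorm : ∀ (ℓ a : ℕ) (b β : ℤ), ℓ.Prime → 3 < ℓ → 0 < a → 0 < β → ℓ ∣ a → ¬ (ℓ : ℤ) ∣ b →
      (a : ℤ) ∣ β ^ 2 + b →
      (∀ p : ℕ, p.Prime → p ∣ a → ∃ e : ℕ, p ^ e ∣ a ∧ ¬ ((p : ℤ) ^ e ∣ 2 * β)) →
      (∃ p : ℕ, p.Prime ∧ p ∣ a ∧ a < p ^ 2 ∧ 2 * β < p) →
      (∀ n : ℤ, RatCongZero ℓ (hurwitzClassNumber (a * n + b))) → False) :
    BRR2022_thm_1 := by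
  intro ℓ a₀ b₀ hℓ h3 ha₀ hsq hcong
  by_contra hb₀
  -- `ℓ ∣ a₀` by the 2020 theorem
  have hℓa₀ : ℓ ∣ a₀ := h20 ℓ a₀ b₀ hℓ h3 ha₀ hsq hcong
  -- a POSITIVE square root `β` of `-b₀` modulo `a₀`
  obtain ⟨x, hx⟩ := hsq
  obtain ⟨β, hβ, hβsq⟩ : ∃ β : ℤ, 0 < β ∧ (a₀ : ℤ) ∣ β ^ 2 + b₀ := by
    rcases eq_or_ne x 0 with rfl | hx0
    · refine ⟨a₀, by exact_mod_cast ha₀, ?_⟩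
      have : (a₀ : ℤ) ∣ b₀ := by simpa using hx
      exact dvd_add (dvd_pow_self _ two_ne_zero) this
    · exact ⟨|x|, abs_pos.mpr hx0, by rwa [sq_abs]⟩
  have hℓβ : ¬ (ℓ : ℤ) ∣ β :=
    not_dvd_of_dvd_of_dvd_sq_add (Int.natCast_dvd_natCast.mpr hℓa₀) hβsq hb₀
  -- normalise the progression (Lemma 2.1)
  obtain ⟨a, b, ha, ha₀a, hbb₀, hsq', h3', h4'⟩ := exists_normalisedProgression ha₀ hβ hβsq
  have hℓb : ¬ (ℓ : ℤ) ∣ b := by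
    intro h
    apply hb₀
    have hd : (ℓ : ℤ) ∣ b - b₀ :=
      ((Int.ModEq.of_dvd (Int.natCast_dvd_natCast.mpr hℓa₀) hbb₀).symm).dvd
    simpa using Int.dvd_sub h hd
  exact hnorm ℓ a b β hℓ h3 ha hβ (hℓa₀.trans ha₀a) hℓb hsq' h3' h4'
    (hurwitzCongruence_of_dvd_of_modEq hcong ha₀a hbb₀)

end BRR2022

end Literature.NumberTheory.QuadraticFields
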